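import Summits.QuantumAdvantage.QuantumAdvantage.Theorems.SosSandwichPseudoBoundedAAClassicalCornerRobust
import Summits.QuantumAdvantage.QuantumAdvantage.Theorems.SosSandwichPseudoBoundedAARoundingLine
import HarnessLib

/-!
# Crux `PseudoBoundedAA` (stmt-QuantumAdvantage-15237, route SosSandwich) — PB-AA ⟺ `L²`-DEQUANTIZATION of the
# sandwich class in the top band (kernel equivalence)

File 4 of the CLASSICAL CORNER of PB-AA (file 3 `…ClassicalCornerRobust.lean`: the robust classical corner
`4·Var² ≤ D̄²·maxInf` for any `p` `L²`-close to a mixture of decision trees).  This thin file sits in the route's module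
cone on purpose (it names the route decl, as `…RoundingLine.lean` does):

* `pseudoBoundedAA_of_randomizedApprox` — the crux follows from "RANDOMIZED SHALLOW APPROXIMATION in the top band"
  `RA := ∃ η > 0, ∃ c C > 0, ∀ N T p, 1 ≤ T → p ∈ K_T → Var[p] ≥ 1/4 − η → ∃ a finite mixture of decision trees, weights
  ≥ 0 summing to ≤ 1, every depth ≤ C·T^c, with 4·E(p − acc)² ≤ Var[p]` (robust classical corner + the tree's top-band
  normal form `CornerLift.pseudoBoundedAA_of_topBand`);
* `randomizedApprox_of_shallowRounding`, `randomizedApprox_of_pseudoBoundedAA` — conversely PB-AA ⟹ RA, through the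
  tree's `BooleanCorner.shallowRounding_of_pseudoBoundedAA` (Aaronson–Ambainis simulation + rounding: a total Boolean
  `f` with `D(f) ≤ C·T^c` is a one-tree mixture);
* **`pseudoBoundedAA_iff_randomizedApprox`** — KERNEL EQUIVALENCE: the rank-2 crux PB-AA holds iff every pseudo-bounded
  polynomial of order `T` with variance `≥ 1/4 − η` (in particular every `T`-query QUANTUM acceptance probability in the
  top band) is approximated to within half a standard deviation in `L²` by the acceptance probability of a randomized
  CLASSICAL algorithm making `poly(T)` queries.  PB-AA is exactly an average-case dequantization statement for `K_T`.

Honest label: an equivalent form of an open crux; no stub, crux or summit is closed.  Sources: O'Donnell–Saks–Schramm–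
Servedio, FOCS 2005, Thm 3.2; Aaronson–Ambainis arXiv:0911.0996 Conj. 6, Thm. 7, Thm. 21.
-/

set_option linter.dupNamespace false

noncomputable section

namespace Summit.QuantumAdvantage.QuantumAdvantage.Theorems.SosSandwich

open Finset Function
open Literature.Computability.Complexity Literature.Computability.QuantumComplexity

namespace ClassicalCorner

variable {N : ℕ}

/-! ### PB-AA ⟺ randomized shallow approximation in the top band -/

/-- **The randomized-approximation line closes the crux.** HYPOTHESIS `RA` ("randomized shallow approximation in the top
band"): for some absolute `η > 0`, `c`, `C > 0`, every `p ∈ K_T` (`T ≥ 1`) with `Var[p] ≥ 1/4 − η` is within a quarter of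
its variance, in `L²`, of the acceptance probability of SOME finite mixture of decision trees with nonnegative weights
summing to at most `1` and every depth `≤ C·T^c`.  CONCLUSION: the route item `SosSandwich.PseudoBoundedAA` — by the robust
classical corner (`4 Var² ≤ (C T^c)²·maxInf`) and the tree's top-band normal form `CornerLift.pseudoBoundedAA_of_topBand`.
[cite: OdonnellEtAl2005, Thm 3.2] [cite: AaronsonAmbainis2014, Conj. 6 and Thm. 7] -/
theorem pseudoBoundedAA_of_randomizedApprox
    (hRA : ∃ η : ℝ, 0 < η ∧ ∃ (c : ℕ) (C : ℝ), 0 < C ∧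
      ∀ (N T : ℕ) (p : MvPolynomial (Fin N) ℝ), 1 ≤ T → PseudoBounded T p → 1 / 4 - η ≤ boolVariance p →
        ∃ (m : ℕ) (w : Fin m → ℝ) (t : Fin m → DecisionTree N), (∀ k, 0 ≤ w k) ∧ ∑ k, w k ≤ 1 ∧
          (∀ k, ((t k).depth : ℝ) ≤ C * (T : ℝ) ^ c) ∧
          4 * boolAvg (fun x => (evalBool p x -
              ∑ k, w k * (if (t k).eval x = true then (1 : ℝ) else 0)) ^ 2) ≤ boolVariance p) :
    Summit.QuantumAdvantage.QuantumAdvantage.Theses.SosSandwich.PseudoBoundedAA := by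
  obtain ⟨η, hη, c, C, hC, hRA⟩ := hRA
  refine CornerLift.pseudoBoundedAA_of_topBand ⟨min η (1 / 8), lt_min hη (by norm_num), 2 * c,
    1 / (16 * C ^ 2), by positivity, ?_⟩
  intro N T p hT hp hv
  have hv' : 1 / 4 - η ≤ boolVariance p := le_trans (by linarith [min_le_left η (1 / 8)]) hv
  have hv8 : 1 / 8 ≤ boolVariance p := le_trans (by linarith [min_le_right η (1 / 8)]) hv
  have hvpos : 0 < boolVariance p := lt_of_lt_of_le (by norm_num) hv8
  obtain ⟨m, w, t, hw, hw1, hdepth, happrox⟩ := hRA N T p hT hp hv'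
  obtain ⟨j, hj⟩ := exists_influence_ge_of_near_mixture_depth_le Finset.univ w (fun k _ => hw k) hw1 t
    (C * (T : ℝ) ^ c) (fun k _ => hdepth k) p happrox hvpos
  refine ⟨j, ?_⟩
  have hT1 : (1 : ℝ) ≤ T := by exact_mod_cast hT
  have hTc : (0 : ℝ) < (T : ℝ) ^ c := by positivity
  have hI := influence_nonneg j p
  have h2 : 4 * (1 / 8 : ℝ) ^ 2 ≤ (C * (T : ℝ) ^ c) ^ 2 * influence j p := le_trans (by gcongr) hj
  rw [div_le_iff₀ (by positivity : (0 : ℝ) < (T : ℝ) ^ (2 * c))]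
  have hpow : (T : ℝ) ^ (2 * c) = ((T : ℝ) ^ c) ^ 2 := by rw [pow_mul']
  rw [hpow]
  have hCT : (0 : ℝ) < C ^ 2 * ((T : ℝ) ^ c) ^ 2 := by positivity
  have h3 : 1 / 16 ≤ C ^ 2 * ((T : ℝ) ^ c) ^ 2 * influence j p := by nlinarith
  calc 1 / (16 * C ^ 2) = (1 / 16) / C ^ 2 := by rw [div_div]
    _ ≤ (C ^ 2 * ((T : ℝ) ^ c) ^ 2 * influence j p) / C ^ 2 := by gcongr
    _ = influence j p * ((T : ℝ) ^ c) ^ 2 := by field_simp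

/-- **Shallow rounding ⟹ randomized shallow approximation**: a total Boolean function `f` with `D(f) ≤ C·T^c` is computed
by a decision tree of depth `D(f)`, i.e. by a one-tree mixture of weight `1`, with the same acceptance function `realOf f`.
[folklore] -/
theorem randomizedApprox_of_shallowRounding
    (hRS : ∃ η : ℝ, 0 < η ∧ ∃ (c : ℕ) (C : ℝ), 0 < C ∧
      ∀ (N T : ℕ) (p : MvPolynomial (Fin N) ℝ), 1 ≤ T → PseudoBounded T p → 1 / 4 - η ≤ boolVariance p →
        ∃ f : (Fin N → Bool) → Bool, (detQueryComplexity f : ℝ) ≤ C * (T : ℝ) ^ c ∧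
          4 * boolAvg (fun x => (evalBool p x - realOf f x) ^ 2) ≤ boolVariance p) :
    ∃ η : ℝ, 0 < η ∧ ∃ (c : ℕ) (C : ℝ), 0 < C ∧
      ∀ (N T : ℕ) (p : MvPolynomial (Fin N) ℝ), 1 ≤ T → PseudoBounded T p → 1 / 4 - η ≤ boolVariance p →
        ∃ (m : ℕ) (w : Fin m → ℝ) (t : Fin m → DecisionTree N), (∀ k, 0 ≤ w k) ∧ ∑ k, w k ≤ 1 ∧
          (∀ k, ((t k).depth : ℝ) ≤ C * (T : ℝ) ^ c) ∧
          4 * boolAvg (fun x => (evalBool p x -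
              ∑ k, w k * (if (t k).eval x = true then (1 : ℝ) else 0)) ^ 2) ≤ boolVariance p := by
  obtain ⟨η, hη, c, C, hC, hRS⟩ := hRS
  refine ⟨η, hη, c, C, hC, fun N T p hT hp hv => ?_⟩
  obtain ⟨f, hD, happrox⟩ := hRS N T p hT hp hv
  obtain ⟨tf, hdepth, hcomp⟩ := exists_depth_eq_detQueryComplexity f
  refine ⟨1, fun _ => 1, fun _ => tf, fun _ => zero_le_one, by simp, fun _ => ?_, ?_⟩
  · rw [hdepth]; exact hD
  · have hacc : ∀ x, ∑ k : Fin 1, (1 : ℝ) * (if (tf).eval x = true then (1 : ℝ) else 0) = realOf f x := by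
      intro x
      rw [Fin.sum_univ_one, one_mul, realOf_apply, hcomp x]
    simp only [hacc]
    exact happrox

/-- **PB-AA ⟹ randomized shallow approximation in the top band** (through the tree's rounding line
`BooleanCorner.shallowRounding_of_pseudoBoundedAA`: Aaronson–Ambainis simulation under PB-AA, then threshold).
[cite: AaronsonAmbainis2014, Thm. 21 (proof)] [cite: OdonnellEtAl2005, Thm 3.2] -/
theorem randomizedApprox_of_pseudoBoundedAA
    (hPB : Summit.QuantumAdvantage.QuantumAdvantage.Theses.SosSandwich.PseudoBoundedAA) :
    ∃ η : ℝ, 0 < η ∧ ∃ (c : ℕ) (C : ℝ), 0 < C ∧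
      ∀ (N T : ℕ) (p : MvPolynomial (Fin N) ℝ), 1 ≤ T → PseudoBounded T p → 1 / 4 - η ≤ boolVariance p →
        ∃ (m : ℕ) (w : Fin m → ℝ) (t : Fin m → DecisionTree N), (∀ k, 0 ≤ w k) ∧ ∑ k, w k ≤ 1 ∧
          (∀ k, ((t k).depth : ℝ) ≤ C * (T : ℝ) ^ c) ∧
          4 * boolAvg (fun x => (evalBool p x -
              ∑ k, w k * (if (t k).eval x = true then (1 : ℝ) else 0)) ^ 2) ≤ boolVariance p :=
  randomizedApprox_of_shallowRounding (BooleanCorner.shallowRounding_of_pseudoBoundedAA hPB)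

/-- **KERNEL EQUIVALENCE: PB-AA ⟺ `L²`-dequantization of the sandwich class in the top band.** The rank-2 crux
`SosSandwich.PseudoBoundedAA` holds iff, for some absolute `η > 0`, `c`, `C > 0`, every pseudo-bounded `p` of order
`T ≥ 1` with `Var[p] ≥ 1/4 − η` — in particular the acceptance probability of every `T`-query QUANTUM algorithm in the top
variance band — is within half a standard deviation, in `L²`, of the acceptance probability of a randomized CLASSICAL
algorithm (finite mixture of decision trees) all of whose runs make at most `C·T^c` queries.
[cite: OdonnellEtAl2005, Thm 3.2] [cite: AaronsonAmbainis2014, Conj. 6, Thm. 7 and Thm. 21] -/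
theorem pseudoBoundedAA_iff_randomizedApprox :
    Summit.QuantumAdvantage.QuantumAdvantage.Theses.SosSandwich.PseudoBoundedAA ↔
      ∃ η : ℝ, 0 < η ∧ ∃ (c : ℕ) (C : ℝ), 0 < C ∧
        ∀ (N T : ℕ) (p : MvPolynomial (Fin N) ℝ), 1 ≤ T → PseudoBounded T p → 1 / 4 - η ≤ boolVariance p →
          ∃ (m : ℕ) (w : Fin m → ℝ) (t : Fin m → DecisionTree N), (∀ k, 0 ≤ w k) ∧ ∑ k, w k ≤ 1 ∧
            (∀ k, ((t k).depth : ℝ) ≤ C * (T : ℝ) ^ c) ∧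
            4 * boolAvg (fun x => (evalBool p x -
                ∑ k, w k * (if (t k).eval x = true then (1 : ℝ) else 0)) ^ 2) ≤ boolVariance p :=
  ⟨randomizedApprox_of_pseudoBoundedAA, pseudoBoundedAA_of_randomizedApprox⟩

end ClassicalCorner

end Summit.QuantumAdvantage.QuantumAdvantage.Theorems.SosSandwich

end
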